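import Summits.QuantumFields.YangMills.Theorems.ColdStartUniversalityLatticeLangevinPlaquetteVariance
import Summits.QuantumFields.YangMills.Theorems.ColdStartUniversalityLatticeLangevinBakryEmeryLogSobolev
import Summits.QuantumFields.YangMills.Theorems.ColdStartUniversalityLatticeLangevinBakryEmeryPoincare
import HarnessLib

/-!
# Route `ColdStartUniversality` (fixed-cut-off package, Bakry–Émery side): variance and entropy of a cylinder function from a CARRÉ-DU-CHAMP
# bound under a frame-Hessian bound `K₀ < 2` — `Var(F) ≤ s/(2(1 − K₀/2))`, `Ent(F²) ≤ s/(1 − K₀/2)` when `Γ^A(f) ≤ s`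

Helper file (seat `ym-line-csu-p1`, g38; `--supports stmt-QuantumFields-24809`).  The g25/g26 Bakry–Émery files give the GENERATOR-form Poincaré
and log-Sobolev inequalities for the SU(2) Wilson measure `μ_(β')` on `(ℤ/L)³` under a frame-Hessian bound `K₀ < 2` of the plaquette function
(`wilson_generatorPoincare_of_hessBound`, `wilson_generatorLogSobolev_of_hessBound`).  With the energy identity `−∫F·𝓛f = ½∫Γ^A(f)`
(`two_mul_integral_mul_generator_eq_neg_carre`, after a compactly supported cut-off of `f` near the range of the coordinates) they become
bounds in terms of a pointwise carré-du-champ bound `Γ^A(f) ≤ s`: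
* ★ `wilson_variance_le_of_carre_of_hessBound` — `∫ (F − μF)² dμ_(β') ≤ s/(2(1 − K₀/2))` (the `K₀`-parametric twin of g27's
  `wilson_variance_le_of_carre_uniform`);
* ★ `wilson_entropy_le_of_carre_of_hessBound` — `∫F²log F² dμ_(β') − (∫F²dμ_(β')) log ∫F²dμ_(β') ≤ s/(1 − K₀/2)`.
The sequel `…LipschitzFunctionalInequalities` inserts the sharp link-Lipschitz count `Γ^A(f) ≤ 2Σ_e ℓ_e²` and obtains Shen–Zhu–Zhu's (4.11)–(4.13)
in Lipschitz form.  THEOREMS ONLY, no definition, no sorry.  HONEST FRAMING: FIXED cut-off bookkeeping; nothing `K`-uniform in the sense of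
`UniformColdStartMixing` (24809, ASIDE, not restated); no crux, rung or summit statement is proved; the Yang–Mills mass gap is NOT proved.
-/

set_option autoImplicit false

noncomputable section

namespace Summit.QuantumFields.YangMills.Theorems.ColdStartUniversality

open MeasureTheory ProbabilityTheory Finset Filter Set Metric
open scoped BigOperators NNReal ENNReal Topology
open Literature.Probability.Process Literature.MathematicalPhysics.QuantumFieldTheory
open Literature.MathematicalPhysics.QuantumLattice (fundamentalRep fundamentalLatticeRep continuous_fundamentalRep)

variable {L : ℕ} [NeZero L]

/-! ## Variance and entropy from a carré-du-champ bound, Hessian constant `K₀` as a parameter -/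

/-- ★ **Variance bound from `Γ(f) ≤ s` under a Hessian bound `K₀ < 2`.**  If the frame Hessian of the plaquette function is bounded by
`K₀` (hypothesis `hHess` of `wilson_generatorPoincare_of_hessBound`) and `f ∈ C³` has carré du champ `Γ^A(f) ≤ s` on `SU(2)^E`, then
`∫ (F − ∫F dμ_(β'))² dμ_(β') ≤ s / (2(1 − K₀/2))`, `F = f∘coords` — the `K₀`-parametric twin of g27's `wilson_variance_le_of_carre_uniform`
(Poincaré `(1 − K₀/2)·Var(F) ≤ −∫(F−m)𝓛f` and the energy identity `−∫(F−m)·𝓛f = ½∫Γ^A(f) ≤ s/2`). [cite: ShenZhuZhu2022, §4 Theorem 4.2, Corollary 4.4 (4.11)] -/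
theorem wilson_variance_le_of_carre_of_hessBound (L : ℕ) [NeZero L] (β' K₀ : ℝ) (hK : K₀ < 2)
    (hHess : (∀ (V : (GaugeConfig 3 L (Matrix.specialUnitaryGroup (Fin 2) ℂ))) (Λ : (Edge 3 L × Fin (fundamentalLatticeRep 2).N × Fin (fundamentalLatticeRep 2).N × Bool → ℝ) →L[ℝ] ℝ),
      ∑ n : Edge 3 L × NoiseIdx (fundamentalLatticeRep 2).N, ∑ m : Edge 3 L × NoiseIdx (fundamentalLatticeRep 2).N,
        Λ ((fun q : Edge 3 L × Fin (fundamentalLatticeRep 2).N × Fin (fundamentalLatticeRep 2).N × Bool => if n.1 = q.1 then (fun z : ℂ => if q.2.2.2 then z.im else z.re) (((Real.sqrt 2 : ℂ) • ((fundamentalLatticeRep 2).lieProj (noiseDir n.2) * (fun (ee : Edge 3 L) => Matrix.of fun (i j : Fin (fundamentalLatticeRep 2).N) => (((fun (V : GaugeConfig 3 L (Matrix.specialUnitaryGroup (Fin 2) ℂ)) (q : Edge 3 L × Fin (fundamentalLatticeRep 2).N × Fin (fundamentalLatticeRep 2).N × Bool) => (fun z : ℂ => if q.2.2.2 then z.im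 else z.re) ((fundamentalRep (Fin 2) (V q.1) : Matrix (Fin 2) (Fin 2) ℂ) q.2.1 q.2.2.1)) V (ee, i, j, false) : ℝ) : ℂ) + (((fun (V : GaugeConfig 3 L (Matrix.specialUnitaryGroup (Fin 2) ℂ)) (q : Edge 3 L × Fin (fundamentalLatticeRep 2).N × Fin (fundamentalLatticeRep 2).N × Bool) => (fun z : ℂ => if q.2.2.2 then z.im else z.re) ((fundamentalRep (Fin 2) (V q.1) : Matrix (Fin 2) (Fin 2) ℂ) q.2.1 q.2.2.1)) V (ee, i, j, true) : ℝ) : ℂ) * Complex.I) q.1)) q.2.1 q.2.2.1) else 0)) * Λ ((fun q : Edge 3 L × Fin (fundamentalLatticeRep 2).N × Fin (fundamentalLatticeRep 2).N × Bool => if m.1 = q.1 then (fun z : ℂ => if q.2.2.2 then z.im else z.re) (((Real.sqrt 2 : ℂ) • ((fundamentalLatticeRep 2).lieProj (noiseDir m.2) * (fun (ee : Edge 3 L) => Matrix.of fun (i j : Fin (fundamentalLatticeRep 2).N) => (((fun (V : GaugeConfig 3 L (Matrix.specialUnitaryGroup (Fin 2) ℂ)) (q : Edge 3 L × Fin (fundamentalLatticeRep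 2).N × Fin (fundamentalLatticeRep 2).N × Bool) => (fun z : ℂ => if q.2.2.2 then z.im else z.re) ((fundamentalRep (Fin 2) (V q.1) : Matrix (Fin 2) (Fin 2) ℂ) q.2.1 q.2.2.1)) V (ee, i, j, false) : ℝ) : ℂ) + (((fun (V : GaugeConfig 3 L (Matrix.specialUnitaryGroup (Fin 2) ℂ)) (q : Edge 3 L × Fin (fundamentalLatticeRep 2).N × Fin (fundamentalLatticeRep 2).N × Bool) => (fun z : ℂ => if q.2.2.2 then z.im else z.re) ((fundamentalRep (Fin 2) (V q.1) : Matrix (Fin 2) (Fin 2) ℂ) q.2.1 q.2.2.1)) V (ee, i, j, true) : ℝ) : ℂ) * Complex.I) q.1)) q.2.1 q.2.2.1) else 0)) *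
          fderiv ℝ (fun z : (Edge 3 L × Fin (fundamentalLatticeRep 2).N × Fin (fundamentalLatticeRep 2).N × Bool → ℝ) => fderiv ℝ (fun y : (Edge 3 L × Fin (fundamentalLatticeRep 2).N × Fin (fundamentalLatticeRep 2).N × Bool → ℝ) => β' * ∑ p : Plaquette 3 L, (rootedLoop (fun (ee : Edge 3 L) (i j : Fin (fundamentalLatticeRep 2).N) => ((y (ee, i, j, false) : ℝ) : ℂ) + ((y (ee, i, j, true) : ℝ) : ℂ) * Complex.I) (p.1, p.2.1.1) p.2.1.2 false).trace.re) z (fun q : Edge 3 L × Fin (fundamentalLatticeRep 2).N × Fin (fundamentalLatticeRep 2).N × Bool => if m.1 = q.1 then (fun z : ℂ => if q.2.2.2 then z.im else z.re) (((Real.sqrt 2 : ℂ) • ((fundamentalLatticeRep 2).lieProj (noiseDir m.2) * (fun (ee : Edge 3 L) => Matrix.of fun (i j : Fin (fundamentalLatticeRep 2).N) => ((z (ee, i, j, false) : ℝ) : ℂ) + ((z (ee, i, j, true) : ℝ) : ℂ) * Complex.I) q.1)) q.2.1 q.2.2.1) else 0)) ((fun (V : GaugeConfig 3 L (Matrix.specialUnitaryGroup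 (Fin 2) ℂ)) (q : Edge 3 L × Fin (fundamentalLatticeRep 2).N × Fin (fundamentalLatticeRep 2).N × Bool) => (fun z : ℂ => if q.2.2.2 then z.im else z.re) ((fundamentalRep (Fin 2) (V q.1) : Matrix (Fin 2) (Fin 2) ℂ) q.2.1 q.2.2.1)) V) (fun q : Edge 3 L × Fin (fundamentalLatticeRep 2).N × Fin (fundamentalLatticeRep 2).N × Bool => if n.1 = q.1 then (fun z : ℂ => if q.2.2.2 then z.im else z.re) (((Real.sqrt 2 : ℂ) • ((fundamentalLatticeRep 2).lieProj (noiseDir n.2) * (fun (ee : Edge 3 L) => Matrix.of fun (i j : Fin (fundamentalLatticeRep 2).N) => (((fun (V : GaugeConfig 3 L (Matrix.specialUnitaryGroup (Fin 2) ℂ)) (q : Edge 3 L × Fin (fundamentalLatticeRep 2).N × Fin (fundamentalLatticeRep 2).N × Bool) => (fun z : ℂ => if q.2.2.2 then z.im else z.re) ((fundamentalRep (Fin 2) (V q.1) : Matrix (Fin 2) (Fin 2) ℂ) q.2.1 q.2.2.1)) V (ee, i, j, false) : ℝ) : ℂ) + (((fun (V : GaugeConfig 3 L (Matrix.specialUnitaryGroup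 (Fin 2) ℂ)) (q : Edge 3 L × Fin (fundamentalLatticeRep 2).N × Fin (fundamentalLatticeRep 2).N × Bool) => (fun z : ℂ => if q.2.2.2 then z.im else z.re) ((fundamentalRep (Fin 2) (V q.1) : Matrix (Fin 2) (Fin 2) ℂ) q.2.1 q.2.2.1)) V (ee, i, j, true) : ℝ) : ℂ) * Complex.I) q.1)) q.2.1 q.2.2.1) else 0)
        ≤ K₀ * ∑ n : Edge 3 L × NoiseIdx (fundamentalLatticeRep 2).N, (Λ (fun q : Edge 3 L × Fin (fundamentalLatticeRep 2).N × Fin (fundamentalLatticeRep 2).N × Bool => if n.1 = q.1 then (fun z : ℂ => if q.2.2.2 then z.im else z.re) (((Real.sqrt 2 : ℂ) • ((fundamentalLatticeRep 2).lieProj (noiseDir n.2) * (fun (ee : Edge 3 L) => Matrix.of fun (i j : Fin (fundamentalLatticeRep 2).N) => (((fun (V : GaugeConfig 3 L (Matrix.specialUnitaryGroup (Fin 2) ℂ)) (q : Edge 3 L × Fin (fundamentalLatticeRep 2).N × Fin (fundamentalLatticeRep 2).N × Bool) => (fun z : ℂ => if q.2.2.2 then z.im else z.re) ((fundamentalRep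 (Fin 2) (V q.1) : Matrix (Fin 2) (Fin 2) ℂ) q.2.1 q.2.2.1)) V (ee, i, j, false) : ℝ) : ℂ) + (((fun (V : GaugeConfig 3 L (Matrix.specialUnitaryGroup (Fin 2) ℂ)) (q : Edge 3 L × Fin (fundamentalLatticeRep 2).N × Fin (fundamentalLatticeRep 2).N × Bool) => (fun z : ℂ => if q.2.2.2 then z.im else z.re) ((fundamentalRep (Fin 2) (V q.1) : Matrix (Fin 2) (Fin 2) ℂ) q.2.1 q.2.2.1)) V (ee, i, j, true) : ℝ) : ℂ) * Complex.I) q.1)) q.2.1 q.2.2.1) else 0)) ^ 2))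
    (f : (Edge 3 L × Fin 2 × Fin 2 × Bool → ℝ) → ℝ) (hf : ContDiff ℝ 3 f) (s : ℝ) :
    let coords : GaugeConfig 3 L (Matrix.specialUnitaryGroup (Fin 2) ℂ) → (Edge 3 L × Fin 2 × Fin 2 × Bool → ℝ) :=
      fun V q => (fun z : ℂ => if q.2.2.2 then z.im else z.re)
        ((fundamentalRep (Fin 2) (V q.1) : Matrix (Fin 2) (Fin 2) ℂ) q.2.1 q.2.2.1)
    let A : GaugeConfig 3 L (Matrix.specialUnitaryGroup (Fin 2) ℂ) → (Edge 3 L × Fin 2 × Fin 2 × Bool) →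
        (Edge 3 L × Fin 2 × Fin 2 × Bool) → ℝ := fun V i j =>
      ∑ n : Edge 3 L × NoiseIdx 2,
        (if n.1 = i.1 then (fun z : ℂ => if i.2.2.2 then z.im else z.re)
          ((latticeLangevinDynamics (fundamentalLatticeRep 2) β').noise
            (matrixConfig (fundamentalRep (Fin 2)) V) i.1 n.2 i.2.1 i.2.2.1) else 0) *
        (if n.1 = j.1 then (fun z : ℂ => if j.2.2.2 then z.im else z.re)
          ((latticeLangevinDynamics (fundamentalLatticeRep 2) β').noise
            (matrixConfig (fundamentalRep (Fin 2)) V) j.1 n.2 j.2.1 j.2.2.1) else 0)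
    (∀ V, (∑ i : Edge 3 L × Fin 2 × Fin 2 × Bool, ∑ j : Edge 3 L × Fin 2 × Fin 2 × Bool, fderiv ℝ f (coords V) (Pi.single i 1) * fderiv ℝ f (coords V) (Pi.single j 1) * A V i j) ≤ s) →
      ∫ V, (f (coords V) - ∫ V', f (coords V') ∂(wilsonMeasure (d := 3) (L := L) (fundamentalRep (Fin 2)) β')) ^ 2 ∂(wilsonMeasure (d := 3) (L := L) (fundamentalRep (Fin 2)) β') ≤ s / (2 * (1 - K₀ / 2)) := by
  intro coords A hΓ
  classical
  haveI := secondCountableTopology_su2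
  haveI := borelSpace_config L
  set μ : Measure (GaugeConfig 3 L (Matrix.specialUnitaryGroup (Fin 2) ℂ)) := (wilsonMeasure (d := 3) (L := L) (fundamentalRep (Fin 2)) β') with hμ
  haveI : IsProbabilityMeasure μ :=
    isProbabilityMeasure_wilsonMeasure (d := 3) (L := L) (fundamentalRep (Fin 2)) (continuous_fundamentalRep (Fin 2)) β'
  have hρ : 0 < 1 - K₀ / 2 := by linarith
  have hco : Continuous coords := continuous_coords (L := L)
  let gen : ((Edge 3 L × Fin 2 × Fin 2 × Bool → ℝ) → ℝ) → GaugeConfig 3 L (Matrix.specialUnitaryGroup (Fin 2) ℂ) → ℝ :=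
      fun h V =>
      (∑ i : Edge 3 L × Fin 2 × Fin 2 × Bool, fderiv ℝ h (coords V) (Pi.single i 1) *
          (fun z : ℂ => if i.2.2.2 then z.im else z.re)
            ((latticeLangevinDynamics (fundamentalLatticeRep 2) β').drift
              (matrixConfig (fundamentalRep (Fin 2)) V) i.1 i.2.1 i.2.2.1) +
      1 / 2 * ∑ i : Edge 3 L × Fin 2 × Fin 2 × Bool, ∑ j : Edge 3 L × Fin 2 × Fin 2 × Bool,
        fderiv ℝ (fun z => fderiv ℝ h z (Pi.single i 1)) (coords V) (Pi.single j 1) *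
          ∑ n : Edge 3 L × NoiseIdx 2,
            (if n.1 = i.1 then (fun z : ℂ => if i.2.2.2 then z.im else z.re)
              ((latticeLangevinDynamics (fundamentalLatticeRep 2) β').noise
                (matrixConfig (fundamentalRep (Fin 2)) V) i.1 n.2 i.2.1 i.2.2.1) else 0) *
            (if n.1 = j.1 then (fun z : ℂ => if j.2.2.2 then z.im else z.re)
              ((latticeLangevinDynamics (fundamentalLatticeRep 2) β').noise
                (matrixConfig (fundamentalRep (Fin 2)) V) j.1 n.2 j.2.1 j.2.2.1) else 0))
  set m : ℝ := ∫ V', f (coords V') ∂μ with hm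
  -- the centred function and its derivatives
  set h : (Edge 3 L × Fin 2 × Fin 2 × Bool → ℝ) → ℝ := fun z => f z - m with hhdef
  have hh : ContDiff ℝ 3 h := hf.sub contDiff_const
  have hfd_h : fderiv ℝ h = fderiv ℝ f := by
    funext z
    exact fderiv_sub_const m
  have hhV : ∀ V : (GaugeConfig 3 L (Matrix.specialUnitaryGroup (Fin 2) ℂ)), h (coords V) = f (coords V) - m := fun V => rfl
  have hgenh : ∀ V : (GaugeConfig 3 L (Matrix.specialUnitaryGroup (Fin 2) ℂ)), gen h V = gen f V := fun V => by simp only [gen, hfd_h]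
  -- Poincaré
  have hP : (1 - K₀ / 2) * ∫ V, (f (coords V) - m) ^ 2 ∂μ ≤ -∫ V, (f (coords V) - m) * gen f V ∂μ :=
    wilson_generatorPoincare_of_hessBound L β' K₀ hK hHess f hf
  -- a compactly supported copy of `h`
  let χ : ContDiffBump (0 : (Edge 3 L × Fin 2 × Fin 2 × Bool → ℝ)) := ⟨2, 3, by norm_num, by norm_num⟩
  set g₁ : (Edge 3 L × Fin 2 × Fin 2 × Bool → ℝ) → ℝ := fun y => (χ : (Edge 3 L × Fin 2 × Fin 2 × Bool → ℝ) → ℝ) y * h y with hg₁def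
  have hg₁ : ContDiff ℝ 3 g₁ := χ.contDiff.mul hh
  have hg₁c : HasCompactSupport g₁ := χ.hasCompactSupport.mul_right
  have hball : ∀ V : (GaugeConfig 3 L (Matrix.specialUnitaryGroup (Fin 2) ℂ)), coords V ∈ ball (0 : (Edge 3 L × Fin 2 × Fin 2 × Bool → ℝ)) 2 := by
    intro V
    rw [mem_ball, dist_zero_right]
    exact (norm_coords_le_one V).trans_lt (by norm_num)
  have hg₁ev : ∀ V : (GaugeConfig 3 L (Matrix.specialUnitaryGroup (Fin 2) ℂ)), g₁ =ᶠ[𝓝 (coords V)] h := by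
    intro V
    filter_upwards [isOpen_ball.mem_nhds (hball V)] with z hz
    have h1 : (χ : (Edge 3 L × Fin 2 × Fin 2 × Bool → ℝ) → ℝ) z = 1 := χ.one_of_mem_closedBall (ball_subset_closedBall hz)
    simp only [hg₁def, h1, one_mul]
  have hg₁val : ∀ V : (GaugeConfig 3 L (Matrix.specialUnitaryGroup (Fin 2) ℂ)), g₁ (coords V) = h (coords V) := fun V => (hg₁ev V).self_of_nhds
  have hg₁gen : ∀ V : (GaugeConfig 3 L (Matrix.specialUnitaryGroup (Fin 2) ℂ)), gen g₁ V = gen h V := fun V => generator_congr_of_eventuallyEq L β' V (hg₁ev V)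
  have hg₁fd : ∀ V : (GaugeConfig 3 L (Matrix.specialUnitaryGroup (Fin 2) ℂ)), fderiv ℝ g₁ (coords V) = fderiv ℝ f (coords V) := fun V => by
    rw [(hg₁ev V).fderiv_eq, hfd_h]
  -- the energy identity for `g₁` and `Γ(g₁) = Γ(f)` on the configuration space
  have hEn : 2 * ∫ V, g₁ (coords V) * gen g₁ V ∂μ = -∫ V, (∑ i : Edge 3 L × Fin 2 × Fin 2 × Bool, ∑ j : Edge 3 L × Fin 2 × Fin 2 × Bool, fderiv ℝ g₁ (coords V) (Pi.single i 1) * fderiv ℝ g₁ (coords V) (Pi.single j 1) * A V i j) ∂μ :=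
    two_mul_integral_mul_generator_eq_neg_carre L β' hg₁ hg₁c
  have hcarre : ∀ V : (GaugeConfig 3 L (Matrix.specialUnitaryGroup (Fin 2) ℂ)), (∑ i : Edge 3 L × Fin 2 × Fin 2 × Bool, ∑ j : Edge 3 L × Fin 2 × Fin 2 × Bool, fderiv ℝ g₁ (coords V) (Pi.single i 1) * fderiv ℝ g₁ (coords V) (Pi.single j 1) * A V i j) = (∑ i : Edge 3 L × Fin 2 × Fin 2 × Bool, ∑ j : Edge 3 L × Fin 2 × Fin 2 × Bool, fderiv ℝ f (coords V) (Pi.single i 1) * fderiv ℝ f (coords V) (Pi.single j 1) * A V i j) := by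
    intro V
    simp only [hg₁fd V]
  -- continuity of `Γ(f)` (for integrability)
  have hreim : ∀ (c : Bool) {φ : (GaugeConfig 3 L (Matrix.specialUnitaryGroup (Fin 2) ℂ)) → ℂ}, Continuous φ → Continuous fun V => (fun z : ℂ => if c then z.im else z.re) (φ V) := by
    intro c φ hφ; cases c
    · exact Complex.continuous_re.comp hφ
    · exact Complex.continuous_im.comp hφ
  have hnoise : ∀ (i : Edge 3 L × Fin 2 × Fin 2 × Bool) (n : Edge 3 L × NoiseIdx 2), Continuous fun V : (GaugeConfig 3 L (Matrix.specialUnitaryGroup (Fin 2) ℂ)) =>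
      (if n.1 = i.1 then (fun z : ℂ => if i.2.2.2 then z.im else z.re)
        ((latticeLangevinDynamics (fundamentalLatticeRep 2) β').noise (matrixConfig (fundamentalRep (Fin 2)) V)
          i.1 n.2 i.2.1 i.2.2.1) else 0) := by
    intro i n
    by_cases h : n.1 = i.1
    · simp only [if_pos h]
      exact hreim _ ((continuous_apply i.2.2.1).comp ((continuous_apply i.2.1).comp
        (continuous_noise_matrixConfig β' i.1 n.2)))
    · simp only [if_neg h]; exact continuous_const
  have hA : ∀ i j, Continuous fun V : (GaugeConfig 3 L (Matrix.specialUnitaryGroup (Fin 2) ℂ)) => A V i j := fun i j =>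
    continuous_finsetSum _ fun n _ => (hnoise i n).mul (hnoise j n)
  have hdf : ∀ v : (Edge 3 L × Fin 2 × Fin 2 × Bool → ℝ), Continuous fun V : (GaugeConfig 3 L (Matrix.specialUnitaryGroup (Fin 2) ℂ)) => fderiv ℝ f (coords V) v := fun v =>
    ((hf.continuous_fderiv (by norm_num)).clm_apply continuous_const).comp hco
  have hΓc : Continuous fun V : (GaugeConfig 3 L (Matrix.specialUnitaryGroup (Fin 2) ℂ)) => (∑ i : Edge 3 L × Fin 2 × Fin 2 × Bool, ∑ j : Edge 3 L × Fin 2 × Fin 2 × Bool, fderiv ℝ f (coords V) (Pi.single i 1) * fderiv ℝ f (coords V) (Pi.single j 1) * A V i j) :=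
    continuous_finsetSum _ fun i _ => continuous_finsetSum _ fun j _ => ((hdf _).mul (hdf _)).mul (hA i j)
  -- `−∫ (F − m)·𝓛f = ½ ∫ Γ(f) ≤ s/2`
  have e1 : ∫ V, (f (coords V) - m) * gen f V ∂μ = ∫ V, g₁ (coords V) * gen g₁ V ∂μ :=
    integral_congr_ae (ae_of_all _ fun V => by beta_reduce; rw [hg₁val V, hg₁gen V, hgenh V, hhV V])
  have e2 : -∫ V, (f (coords V) - m) * gen f V ∂μ = 1 / 2 * ∫ V, (∑ i : Edge 3 L × Fin 2 × Fin 2 × Bool, ∑ j : Edge 3 L × Fin 2 × Fin 2 × Bool, fderiv ℝ f (coords V) (Pi.single i 1) * fderiv ℝ f (coords V) (Pi.single j 1) * A V i j) ∂μ := by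
    have e3 : ∫ V, (∑ i : Edge 3 L × Fin 2 × Fin 2 × Bool, ∑ j : Edge 3 L × Fin 2 × Fin 2 × Bool, fderiv ℝ g₁ (coords V) (Pi.single i 1) * fderiv ℝ g₁ (coords V) (Pi.single j 1) * A V i j) ∂μ = ∫ V, (∑ i : Edge 3 L × Fin 2 × Fin 2 × Bool, ∑ j : Edge 3 L × Fin 2 × Fin 2 × Bool, fderiv ℝ f (coords V) (Pi.single i 1) * fderiv ℝ f (coords V) (Pi.single j 1) * A V i j) ∂μ :=
      integral_congr_ae (ae_of_all _ fun V => by beta_reduce; exact hcarre V)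
    rw [e1]
    linarith [hEn, e3]
  have hI : ∫ V, (∑ i : Edge 3 L × Fin 2 × Fin 2 × Bool, ∑ j : Edge 3 L × Fin 2 × Fin 2 × Bool, fderiv ℝ f (coords V) (Pi.single i 1) * fderiv ℝ f (coords V) (Pi.single j 1) * A V i j) ∂μ ≤ s := by
    have hi1 : Integrable (fun V : (GaugeConfig 3 L (Matrix.specialUnitaryGroup (Fin 2) ℂ)) => (∑ i : Edge 3 L × Fin 2 × Fin 2 × Bool, ∑ j : Edge 3 L × Fin 2 × Fin 2 × Bool, fderiv ℝ f (coords V) (Pi.single i 1) * fderiv ℝ f (coords V) (Pi.single j 1) * A V i j)) μ := integrable_of_continuous_of_compactSpace hΓc _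
    have hi2 : Integrable (fun _ : (GaugeConfig 3 L (Matrix.specialUnitaryGroup (Fin 2) ℂ)) => s) μ := integrable_const s
    have hmono := integral_mono hi1 hi2 fun V => hΓ V
    have hc : ∫ _ : (GaugeConfig 3 L (Matrix.specialUnitaryGroup (Fin 2) ℂ)), s ∂μ = s := by
      rw [integral_const]; simp
    rw [hc] at hmono
    exact hmono
  have hkey : (1 - K₀ / 2) * ∫ V, (f (coords V) - m) ^ 2 ∂μ ≤ s / 2 := by
    rw [e2] at hP
    linarith
  rw [le_div_iff₀ (by positivity)]
  linarith

/-- ★ **Entropy bound from `Γ(f) ≤ s` under a Hessian bound `K₀ < 2`.**  If the frame Hessian of the plaquette function is bounded by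
`K₀` and `f ∈ C³` has `Γ^A(f) ≤ s` on `SU(2)^E`, then `Ent_(μ_β')(F²) := ∫ F² log F² dμ_(β') − (∫F² dμ_(β')) log ∫F² dμ_(β') ≤ s / (1 − K₀/2)`,
`F = f∘coords` (log-Sobolev `((2 − K₀)/4)·Ent(F²) ≤ −∫F𝓛f`, `wilson_generatorLogSobolev_of_hessBound`, and the energy identity
`−∫F·𝓛f = ½∫Γ^A(f) ≤ s/2`). [cite: ShenZhuZhu2022, §4 Theorem 4.2, Corollary 4.4 (4.11)] -/
theorem wilson_entropy_le_of_carre_of_hessBound (L : ℕ) [NeZero L] (β' K₀ : ℝ) (hK : K₀ < 2)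
    (hHess : (∀ (V : (GaugeConfig 3 L (Matrix.specialUnitaryGroup (Fin 2) ℂ))) (Λ : (Edge 3 L × Fin (fundamentalLatticeRep 2).N × Fin (fundamentalLatticeRep 2).N × Bool → ℝ) →L[ℝ] ℝ),
      ∑ n : Edge 3 L × NoiseIdx (fundamentalLatticeRep 2).N, ∑ m : Edge 3 L × NoiseIdx (fundamentalLatticeRep 2).N,
        Λ ((fun q : Edge 3 L × Fin (fundamentalLatticeRep 2).N × Fin (fundamentalLatticeRep 2).N × Bool => if n.1 = q.1 then (fun z : ℂ => if q.2.2.2 then z.im else z.re) (((Real.sqrt 2 : ℂ) • ((fundamentalLatticeRep 2).lieProj (noiseDir n.2) * (fun (ee : Edge 3 L) => Matrix.of fun (i j : Fin (fundamentalLatticeRep 2).N) => (((fun (V : GaugeConfig 3 L (Matrix.specialUnitaryGroup (Fin 2) ℂ)) (q : Edge 3 L × Fin (fundamentalLatticeRep 2).N × Fin (fundamentalLatticeRep 2).N × Bool) => (fun z : ℂ => if q.2.2.2 then z.im else z.re) ((fundamentalRep (Fin 2) (V q.1) : Matrix (Fin 2) (Fin 2) ℂ) q.2.1 q.2.2.1))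 V (ee, i, j, false) : ℝ) : ℂ) + (((fun (V : GaugeConfig 3 L (Matrix.specialUnitaryGroup (Fin 2) ℂ)) (q : Edge 3 L × Fin (fundamentalLatticeRep 2).N × Fin (fundamentalLatticeRep 2).N × Bool) => (fun z : ℂ => if q.2.2.2 then z.im else z.re) ((fundamentalRep (Fin 2) (V q.1) : Matrix (Fin 2) (Fin 2) ℂ) q.2.1 q.2.2.1)) V (ee, i, j, true) : ℝ) : ℂ) * Complex.I) q.1)) q.2.1 q.2.2.1) else 0)) * Λ ((fun q : Edge 3 L × Fin (fundamentalLatticeRep 2).N × Fin (fundamentalLatticeRep 2).N × Bool => if m.1 = q.1 then (fun z : ℂ => if q.2.2.2 then z.im else z.re) (((Real.sqrt 2 : ℂ) • ((fundamentalLatticeRep 2).lieProj (noiseDir m.2) * (fun (ee : Edge 3 L) => Matrix.of fun (i j : Fin (fundamentalLatticeRep 2).N) => (((fun (V : GaugeConfig 3 L (Matrix.specialUnitaryGroup (Fin 2) ℂ)) (q : Edge 3 L × Fin (fundamentalLatticeRep 2).N × Fin (fundamentalLatticeRep 2).N × Bool) => (fun z : ℂ => if q.2.2.2 then z.im else z.re)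 ((fundamentalRep (Fin 2) (V q.1) : Matrix (Fin 2) (Fin 2) ℂ) q.2.1 q.2.2.1)) V (ee, i, j, false) : ℝ) : ℂ) + (((fun (V : GaugeConfig 3 L (Matrix.specialUnitaryGroup (Fin 2) ℂ)) (q : Edge 3 L × Fin (fundamentalLatticeRep 2).N × Fin (fundamentalLatticeRep 2).N × Bool) => (fun z : ℂ => if q.2.2.2 then z.im else z.re) ((fundamentalRep (Fin 2) (V q.1) : Matrix (Fin 2) (Fin 2) ℂ) q.2.1 q.2.2.1)) V (ee, i, j, true) : ℝ) : ℂ) * Complex.I) q.1)) q.2.1 q.2.2.1) else 0)) *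
          fderiv ℝ (fun z : (Edge 3 L × Fin (fundamentalLatticeRep 2).N × Fin (fundamentalLatticeRep 2).N × Bool → ℝ) => fderiv ℝ (fun y : (Edge 3 L × Fin (fundamentalLatticeRep 2).N × Fin (fundamentalLatticeRep 2).N × Bool → ℝ) => β' * ∑ p : Plaquette 3 L, (rootedLoop (fun (ee : Edge 3 L) (i j : Fin (fundamentalLatticeRep 2).N) => ((y (ee, i, j, false) : ℝ) : ℂ) + ((y (ee, i, j, true) : ℝ) : ℂ) * Complex.I) (p.1, p.2.1.1) p.2.1.2 false).trace.re) z (fun q : Edge 3 L × Fin (fundamentalLatticeRep 2).N × Fin (fundamentalLatticeRep 2).N × Bool => if m.1 = q.1 then (fun z : ℂ => if q.2.2.2 then z.im else z.re) (((Real.sqrt 2 : ℂ) • ((fundamentalLatticeRep 2).lieProj (noiseDir m.2) * (fun (ee : Edge 3 L) => Matrix.of fun (i j : Fin (fundamentalLatticeRep 2).N) => ((z (ee, i, j, false) : ℝ) : ℂ) + ((z (ee, i, j, true) : ℝ) : ℂ) * Complex.I) q.1)) q.2.1 q.2.2.1) else 0)) ((fun (V : GaugeConfig 3 L (Matrix.specialUnitaryGroup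 (Fin 2) ℂ)) (q : Edge 3 L × Fin (fundamentalLatticeRep 2).N × Fin (fundamentalLatticeRep 2).N × Bool) => (fun z : ℂ => if q.2.2.2 then z.im else z.re) ((fundamentalRep (Fin 2) (V q.1) : Matrix (Fin 2) (Fin 2) ℂ) q.2.1 q.2.2.1)) V) (fun q : Edge 3 L × Fin (fundamentalLatticeRep 2).N × Fin (fundamentalLatticeRep 2).N × Bool => if n.1 = q.1 then (fun z : ℂ => if q.2.2.2 then z.im else z.re) (((Real.sqrt 2 : ℂ) • ((fundamentalLatticeRep 2).lieProj (noiseDir n.2) * (fun (ee : Edge 3 L) => Matrix.of fun (i j : Fin (fundamentalLatticeRep 2).N) => (((fun (V : GaugeConfig 3 L (Matrix.specialUnitaryGroup (Fin 2) ℂ)) (q : Edge 3 L × Fin (fundamentalLatticeRep 2).N × Fin (fundamentalLatticeRep 2).N × Bool) => (fun z : ℂ => if q.2.2.2 then z.im else z.re) ((fundamentalRep (Fin 2) (V q.1) : Matrix (Fin 2) (Fin 2) ℂ) q.2.1 q.2.2.1)) V (ee, i, j, false) : ℝ) : ℂ) + (((fun (V : GaugeConfig 3 L (Matrix.specialUnitaryGroup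 (Fin 2) ℂ)) (q : Edge 3 L × Fin (fundamentalLatticeRep 2).N × Fin (fundamentalLatticeRep 2).N × Bool) => (fun z : ℂ => if q.2.2.2 then z.im else z.re) ((fundamentalRep (Fin 2) (V q.1) : Matrix (Fin 2) (Fin 2) ℂ) q.2.1 q.2.2.1)) V (ee, i, j, true) : ℝ) : ℂ) * Complex.I) q.1)) q.2.1 q.2.2.1) else 0)
        ≤ K₀ * ∑ n : Edge 3 L × NoiseIdx (fundamentalLatticeRep 2).N, (Λ (fun q : Edge 3 L × Fin (fundamentalLatticeRep 2).N × Fin (fundamentalLatticeRep 2).N × Bool => if n.1 = q.1 then (fun z : ℂ => if q.2.2.2 then z.im else z.re) (((Real.sqrt 2 : ℂ) • ((fundamentalLatticeRep 2).lieProj (noiseDir n.2) * (fun (ee : Edge 3 L) => Matrix.of fun (i j : Fin (fundamentalLatticeRep 2).N) => (((fun (V : GaugeConfig 3 L (Matrix.specialUnitaryGroup (Fin 2) ℂ)) (q : Edge 3 L × Fin (fundamentalLatticeRep 2).N × Fin (fundamentalLatticeRep 2).N × Bool) => (fun z : ℂ => if q.2.2.2 then z.im else z.re) ((fundamentalRep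 (Fin 2) (V q.1) : Matrix (Fin 2) (Fin 2) ℂ) q.2.1 q.2.2.1)) V (ee, i, j, false) : ℝ) : ℂ) + (((fun (V : GaugeConfig 3 L (Matrix.specialUnitaryGroup (Fin 2) ℂ)) (q : Edge 3 L × Fin (fundamentalLatticeRep 2).N × Fin (fundamentalLatticeRep 2).N × Bool) => (fun z : ℂ => if q.2.2.2 then z.im else z.re) ((fundamentalRep (Fin 2) (V q.1) : Matrix (Fin 2) (Fin 2) ℂ) q.2.1 q.2.2.1)) V (ee, i, j, true) : ℝ) : ℂ) * Complex.I) q.1)) q.2.1 q.2.2.1) else 0)) ^ 2))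
    (f : (Edge 3 L × Fin 2 × Fin 2 × Bool → ℝ) → ℝ) (hf : ContDiff ℝ 3 f) (s : ℝ) :
    let coords : GaugeConfig 3 L (Matrix.specialUnitaryGroup (Fin 2) ℂ) → (Edge 3 L × Fin 2 × Fin 2 × Bool → ℝ) :=
      fun V q => (fun z : ℂ => if q.2.2.2 then z.im else z.re)
        ((fundamentalRep (Fin 2) (V q.1) : Matrix (Fin 2) (Fin 2) ℂ) q.2.1 q.2.2.1)
    let A : GaugeConfig 3 L (Matrix.specialUnitaryGroup (Fin 2) ℂ) → (Edge 3 L × Fin 2 × Fin 2 × Bool) →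
        (Edge 3 L × Fin 2 × Fin 2 × Bool) → ℝ := fun V i j =>
      ∑ n : Edge 3 L × NoiseIdx 2,
        (if n.1 = i.1 then (fun z : ℂ => if i.2.2.2 then z.im else z.re)
          ((latticeLangevinDynamics (fundamentalLatticeRep 2) β').noise
            (matrixConfig (fundamentalRep (Fin 2)) V) i.1 n.2 i.2.1 i.2.2.1) else 0) *
        (if n.1 = j.1 then (fun z : ℂ => if j.2.2.2 then z.im else z.re)
          ((latticeLangevinDynamics (fundamentalLatticeRep 2) β').noise
            (matrixConfig (fundamentalRep (Fin 2)) V) j.1 n.2 j.2.1 j.2.2.1) else 0)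
    (∀ V, (∑ i : Edge 3 L × Fin 2 × Fin 2 × Bool, ∑ j : Edge 3 L × Fin 2 × Fin 2 × Bool, fderiv ℝ f (coords V) (Pi.single i 1) * fderiv ℝ f (coords V) (Pi.single j 1) * A V i j) ≤ s) →
      (∫ V, f (coords V) ^ 2 * Real.log (f (coords V) ^ 2) ∂(wilsonMeasure (d := 3) (L := L) (fundamentalRep (Fin 2)) β')) - (∫ V, f (coords V) ^ 2 ∂(wilsonMeasure (d := 3) (L := L) (fundamentalRep (Fin 2)) β')) * Real.log (∫ V, f (coords V) ^ 2 ∂(wilsonMeasure (d := 3) (L := L) (fundamentalRep (Fin 2)) β')) ≤ s / (1 - K₀ / 2) := by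
  intro coords A hΓ
  classical
  haveI := secondCountableTopology_su2
  haveI := borelSpace_config L
  set μ : Measure (GaugeConfig 3 L (Matrix.specialUnitaryGroup (Fin 2) ℂ)) := (wilsonMeasure (d := 3) (L := L) (fundamentalRep (Fin 2)) β') with hμ
  haveI : IsProbabilityMeasure μ :=
    isProbabilityMeasure_wilsonMeasure (d := 3) (L := L) (fundamentalRep (Fin 2)) (continuous_fundamentalRep (Fin 2)) β'
  have hρ : 0 < 1 - K₀ / 2 := by linarith
  have hco : Continuous coords := continuous_coords (L := L)
  let gen : ((Edge 3 L × Fin 2 × Fin 2 × Bool → ℝ) → ℝ) → GaugeConfig 3 L (Matrix.specialUnitaryGroup (Fin 2) ℂ) → ℝ :=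
      fun h V =>
      (∑ i : Edge 3 L × Fin 2 × Fin 2 × Bool, fderiv ℝ h (coords V) (Pi.single i 1) *
          (fun z : ℂ => if i.2.2.2 then z.im else z.re)
            ((latticeLangevinDynamics (fundamentalLatticeRep 2) β').drift
              (matrixConfig (fundamentalRep (Fin 2)) V) i.1 i.2.1 i.2.2.1) +
      1 / 2 * ∑ i : Edge 3 L × Fin 2 × Fin 2 × Bool, ∑ j : Edge 3 L × Fin 2 × Fin 2 × Bool,
        fderiv ℝ (fun z => fderiv ℝ h z (Pi.single i 1)) (coords V) (Pi.single j 1) *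
          ∑ n : Edge 3 L × NoiseIdx 2,
            (if n.1 = i.1 then (fun z : ℂ => if i.2.2.2 then z.im else z.re)
              ((latticeLangevinDynamics (fundamentalLatticeRep 2) β').noise
                (matrixConfig (fundamentalRep (Fin 2)) V) i.1 n.2 i.2.1 i.2.2.1) else 0) *
            (if n.1 = j.1 then (fun z : ℂ => if j.2.2.2 then z.im else z.re)
              ((latticeLangevinDynamics (fundamentalLatticeRep 2) β').noise
                (matrixConfig (fundamentalRep (Fin 2)) V) j.1 n.2 j.2.1 j.2.2.1) else 0))
  set Ent : ℝ := (∫ V, f (coords V) ^ 2 * Real.log (f (coords V) ^ 2) ∂μ) - (∫ V, f (coords V) ^ 2 ∂μ) * Real.log (∫ V, f (coords V) ^ 2 ∂μ) with hEnt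
  -- log-Sobolev
  have hP : (2 - K₀) / 4 * Ent ≤ -∫ V, f (coords V) * gen f V ∂μ :=
    wilson_generatorLogSobolev_of_hessBound L β' K₀ hK hHess f hf
  -- a compactly supported copy of `f`
  let χ : ContDiffBump (0 : (Edge 3 L × Fin 2 × Fin 2 × Bool → ℝ)) := ⟨2, 3, by norm_num, by norm_num⟩
  set g₁ : (Edge 3 L × Fin 2 × Fin 2 × Bool → ℝ) → ℝ := fun y => (χ : (Edge 3 L × Fin 2 × Fin 2 × Bool → ℝ) → ℝ) y * f y with hg₁def
  have hg₁ : ContDiff ℝ 3 g₁ := χ.contDiff.mul hf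
  have hg₁c : HasCompactSupport g₁ := χ.hasCompactSupport.mul_right
  have hball : ∀ V : (GaugeConfig 3 L (Matrix.specialUnitaryGroup (Fin 2) ℂ)), coords V ∈ ball (0 : (Edge 3 L × Fin 2 × Fin 2 × Bool → ℝ)) 2 := by
    intro V
    rw [mem_ball, dist_zero_right]
    exact (norm_coords_le_one V).trans_lt (by norm_num)
  have hg₁ev : ∀ V : (GaugeConfig 3 L (Matrix.specialUnitaryGroup (Fin 2) ℂ)), g₁ =ᶠ[𝓝 (coords V)] f := by
    intro V
    filter_upwards [isOpen_ball.mem_nhds (hball V)] with z hz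
    have h1 : (χ : (Edge 3 L × Fin 2 × Fin 2 × Bool → ℝ) → ℝ) z = 1 := χ.one_of_mem_closedBall (ball_subset_closedBall hz)
    simp only [hg₁def, h1, one_mul]
  have hg₁val : ∀ V : (GaugeConfig 3 L (Matrix.specialUnitaryGroup (Fin 2) ℂ)), g₁ (coords V) = f (coords V) := fun V => (hg₁ev V).self_of_nhds
  have hg₁gen : ∀ V : (GaugeConfig 3 L (Matrix.specialUnitaryGroup (Fin 2) ℂ)), gen g₁ V = gen f V := fun V => generator_congr_of_eventuallyEq L β' V (hg₁ev V)
  have hg₁fd : ∀ V : (GaugeConfig 3 L (Matrix.specialUnitaryGroup (Fin 2) ℂ)), fderiv ℝ g₁ (coords V) = fderiv ℝ f (coords V) := fun V => by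
    rw [(hg₁ev V).fderiv_eq]
  -- the energy identity for `g₁` and `Γ(g₁) = Γ(f)` on the configuration space
  have hEn : 2 * ∫ V, g₁ (coords V) * gen g₁ V ∂μ = -∫ V, (∑ i : Edge 3 L × Fin 2 × Fin 2 × Bool, ∑ j : Edge 3 L × Fin 2 × Fin 2 × Bool, fderiv ℝ g₁ (coords V) (Pi.single i 1) * fderiv ℝ g₁ (coords V) (Pi.single j 1) * A V i j) ∂μ :=
    two_mul_integral_mul_generator_eq_neg_carre L β' hg₁ hg₁c
  have hcarre : ∀ V : (GaugeConfig 3 L (Matrix.specialUnitaryGroup (Fin 2) ℂ)), (∑ i : Edge 3 L × Fin 2 × Fin 2 × Bool, ∑ j : Edge 3 L × Fin 2 × Fin 2 × Bool, fderiv ℝ g₁ (coords V) (Pi.single i 1) * fderiv ℝ g₁ (coords V) (Pi.single j 1) * A V i j) = (∑ i : Edge 3 L × Fin 2 × Fin 2 × Bool, ∑ j : Edge 3 L × Fin 2 × Fin 2 × Bool, fderiv ℝ f (coords V) (Pi.single i 1) * fderiv ℝ f (coords V) (Pi.single j 1) * A V i j) := by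
    intro V
    simp only [hg₁fd V]
  -- continuity of `Γ(f)` (for integrability)
  have hreim : ∀ (c : Bool) {φ : (GaugeConfig 3 L (Matrix.specialUnitaryGroup (Fin 2) ℂ)) → ℂ}, Continuous φ → Continuous fun V => (fun z : ℂ => if c then z.im else z.re) (φ V) := by
    intro c φ hφ; cases c
    · exact Complex.continuous_re.comp hφ
    · exact Complex.continuous_im.comp hφ
  have hnoise : ∀ (i : Edge 3 L × Fin 2 × Fin 2 × Bool) (n : Edge 3 L × NoiseIdx 2), Continuous fun V : (GaugeConfig 3 L (Matrix.specialUnitaryGroup (Fin 2) ℂ)) =>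
      (if n.1 = i.1 then (fun z : ℂ => if i.2.2.2 then z.im else z.re)
        ((latticeLangevinDynamics (fundamentalLatticeRep 2) β').noise (matrixConfig (fundamentalRep (Fin 2)) V)
          i.1 n.2 i.2.1 i.2.2.1) else 0) := by
    intro i n
    by_cases h : n.1 = i.1
    · simp only [if_pos h]
      exact hreim _ ((continuous_apply i.2.2.1).comp ((continuous_apply i.2.1).comp
        (continuous_noise_matrixConfig β' i.1 n.2)))
    · simp only [if_neg h]; exact continuous_const
  have hA : ∀ i j, Continuous fun V : (GaugeConfig 3 L (Matrix.specialUnitaryGroup (Fin 2) ℂ)) => A V i j := fun i j =>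
    continuous_finsetSum _ fun n _ => (hnoise i n).mul (hnoise j n)
  have hdf : ∀ v : (Edge 3 L × Fin 2 × Fin 2 × Bool → ℝ), Continuous fun V : (GaugeConfig 3 L (Matrix.specialUnitaryGroup (Fin 2) ℂ)) => fderiv ℝ f (coords V) v := fun v =>
    ((hf.continuous_fderiv (by norm_num)).clm_apply continuous_const).comp hco
  have hΓc : Continuous fun V : (GaugeConfig 3 L (Matrix.specialUnitaryGroup (Fin 2) ℂ)) => (∑ i : Edge 3 L × Fin 2 × Fin 2 × Bool, ∑ j : Edge 3 L × Fin 2 × Fin 2 × Bool, fderiv ℝ f (coords V) (Pi.single i 1) * fderiv ℝ f (coords V) (Pi.single j 1) * A V i j) :=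
    continuous_finsetSum _ fun i _ => continuous_finsetSum _ fun j _ => ((hdf _).mul (hdf _)).mul (hA i j)
  -- `−∫ F·𝓛f = ½ ∫ Γ(f) ≤ s/2`
  have e1 : ∫ V, f (coords V) * gen f V ∂μ = ∫ V, g₁ (coords V) * gen g₁ V ∂μ :=
    integral_congr_ae (ae_of_all _ fun V => by beta_reduce; rw [hg₁val V, hg₁gen V])
  have e2 : -∫ V, f (coords V) * gen f V ∂μ = 1 / 2 * ∫ V, (∑ i : Edge 3 L × Fin 2 × Fin 2 × Bool, ∑ j : Edge 3 L × Fin 2 × Fin 2 × Bool, fderiv ℝ f (coords V) (Pi.single i 1) * fderiv ℝ f (coords V) (Pi.single j 1) * A V i j) ∂μ := by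
    have e3 : ∫ V, (∑ i : Edge 3 L × Fin 2 × Fin 2 × Bool, ∑ j : Edge 3 L × Fin 2 × Fin 2 × Bool, fderiv ℝ g₁ (coords V) (Pi.single i 1) * fderiv ℝ g₁ (coords V) (Pi.single j 1) * A V i j) ∂μ = ∫ V, (∑ i : Edge 3 L × Fin 2 × Fin 2 × Bool, ∑ j : Edge 3 L × Fin 2 × Fin 2 × Bool, fderiv ℝ f (coords V) (Pi.single i 1) * fderiv ℝ f (coords V) (Pi.single j 1) * A V i j) ∂μ :=
      integral_congr_ae (ae_of_all _ fun V => by beta_reduce; exact hcarre V)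
    rw [e1]
    linarith [hEn, e3]
  have hI : ∫ V, (∑ i : Edge 3 L × Fin 2 × Fin 2 × Bool, ∑ j : Edge 3 L × Fin 2 × Fin 2 × Bool, fderiv ℝ f (coords V) (Pi.single i 1) * fderiv ℝ f (coords V) (Pi.single j 1) * A V i j) ∂μ ≤ s := by
    have hi1 : Integrable (fun V : (GaugeConfig 3 L (Matrix.specialUnitaryGroup (Fin 2) ℂ)) => (∑ i : Edge 3 L × Fin 2 × Fin 2 × Bool, ∑ j : Edge 3 L × Fin 2 × Fin 2 × Bool, fderiv ℝ f (coords V) (Pi.single i 1) * fderiv ℝ f (coords V) (Pi.single j 1) * A V i j)) μ := integrable_of_continuous_of_compactSpace hΓc _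
    have hi2 : Integrable (fun _ : (GaugeConfig 3 L (Matrix.specialUnitaryGroup (Fin 2) ℂ)) => s) μ := integrable_const s
    have hmono := integral_mono hi1 hi2 fun V => hΓ V
    have hc : ∫ _ : (GaugeConfig 3 L (Matrix.specialUnitaryGroup (Fin 2) ℂ)), s ∂μ = s := by
      rw [integral_const]; simp
    rw [hc] at hmono
    exact hmono
  have hkey : (2 - K₀) / 4 * Ent ≤ s / 2 := by
    rw [e2] at hP
    linarith
  have hring : (1 - K₀ / 2) * Ent = 2 * ((2 - K₀) / 4 * Ent) := by ring
  rw [le_div_iff₀ hρ]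
  linarith

end Summit.QuantumFields.YangMills.Theorems.ColdStartUniversality
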